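import Mathlib
import Summits.Ventures.HodgeRepro.Tier4.TargetV3
import Summits.Ventures.HodgeRepro.Tier4.Common.ConcreteCocompact

/-!
# Tier4/Common/TargetDataV3 — the successor target `P_T4v3` as «∀ datum-without-lifts, ∃ level, lifts, N2, conclusion at that
level», and the concrete assembly with the `∃`

Blind re-derivation cell `pub-hodge-repro`, Tier 4 (README §9–§10), seat t4-typer-1 (gen 1).  Target tree path
`lean/Summits/Ventures/HodgeRepro/Tier4/Common/TargetDataV3.lean`.  Imports `Tier4/TargetV3.lean` (the quantifier-repair successor
of lead g385 S13093 / L7915: `P_T4v3`, `IsCentralModulo`) and `Tier4/Common/ConcreteCocompact.lean` (typer-1 g1: `TargetData`, the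
concrete witness and its assemblies), nothing else of Tier 4.

WHAT IS TYPED.  `P_T4v3` (lead g385 S13115's shape) keeps `P_T4`'s datum — INCLUDING the given lifts `a` at level `Γ` — as the
hypothesis and asserts, for some level `Γ' ≤ Γ`, a RE-CHOSEN quadruple `a'` of Albanese lifts into the same tori at level `Γ'`,
N2-compatible, with Hecke elements of level `Γ'` and a fundamental domain of `Γ'` on which the pairing is non-zero.
`d.relevel Γ' hΓ' a' ha' : TargetData F E` is the `P_T4` datum with `Γ := Γ'` and `a := a'` — so every Common module built on
`TargetData` (the concrete witness, `dom`, the residual bundle, DeepLevel, …) applies to the witness at its own level.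
`TargetData.N2 d` is the `hN2` conjunct on the datum's fields (level `d.Γ`, lifts `d.a`); `TargetData.conclusionAt d Γ'` is «some Hecke
elements of level `Γ'`, some fundamental domain of `Γ'`, non-zero pairing» — `P_T4`'s conclusion with the level FIXED.
**`P_T4v3_iff_forall`** : `P_T4v3 ↔ ∀ F E […] (d : TargetData F E), ∃ Γ' (hΓ' : d.IsLevel Γ') a' ha', (d.relevel Γ' hΓ'.1 a' ha').N2 ∧
(d.relevel Γ' hΓ'.1 a' ha').conclusionAt Γ'` is proved by unfolding, exactly as `P_T4_iff_forall` for `P_T4`.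
`conclusionAt_of_concrete_P_cocompact` : (P) for the concrete witness of a datum at its OWN level on the canonical domain `dom d d.Γ`
gives `d.conclusionAt d.Γ`; **`P_T4v3_of_concrete_cocompact`** assembles `P_T4v3` from: for every datum `d`, a level `Γ'`, lifts `a'`
at `Γ'` with N2, the cocompactness of `Γ'`, and (P) for the concrete witness of `d.relevel Γ' … a' ha'` at level `Γ'` on `dom`.

Nothing here says anything about the status of the Hodge conjecture for CM abelian varieties, which is NOT proved
(HC_CM is NOT proved by anyone in this repository).
-/

set_option autoImplicit false

noncomputable section

open Matrix MeasureTheory NumberField Set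
open scoped ComplexConjugate ComplexOrder

namespace Summit.Ventures.HodgeRepro.Tier4

open Summit.Ventures.HodgeRepro.Tier4.Common

namespace TargetData

variable {F E : Type} [Field F] [NumberField F] [IsGalois ℚ F] [IsCMField F]
  [Field E] [NumberField E] [IsGalois ℚ E] [IsCMField E] (d : TargetData F E)

/-- **The re-levelled datum of a witness of `P_T4v3`**: the level `Γ'` becomes the datum's `Γ`, the re-chosen lifts `a'` (Albanese
lifts at level `Γ'`) its lifts; everything else unchanged. -/
def relevel (Γ' : Set (Matrix (Fin 3) (Fin 3) E)) (hΓ' : IsCongruenceSubgroup (IsCMField.complexConj E).toRingEquiv d.H Γ')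
    (a' : ∀ i : Fin 4, (Fin 2 → ℂ) → (↥(d.T i) → ℂ)) (ha' : ∀ i, IsAlbaneseLift (d.T i) (d.Λ i) d.τ₀ d.C Γ' (a' i)) :
    TargetData F E :=
  ⟨d.T, d.hT, d.hE, d.ι, d.H, d.hH, d.hani, d.τ₀, d.hdef, d.C, d.hC, Γ', hΓ', d.s, d.Λ, d.discrete, d.lattice, d.hΛ, a', ha',
    d.i₁, d.i₂, d.i₃, d.i₄, d.h12, d.h34, d.hs₁, d.hs₂, d.hs₃, d.hs₄⟩

/-- **N2 on the datum** (the `hN2` conjunct of `P_T4v3`, verbatim on the datum's fields, the level being `d.Γ`, the lifts `d.a`). -/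
def N2 : Prop :=
  ∀ N : ℕ, 1 ≤ N → principalCongruence (IsCMField.complexConj E).toRingEquiv d.H N ⊆ d.Γ →
    ∀ γ : Matrix (Fin 3) (Fin 3) E, IsCentralModulo (IsCMField.complexConj E).toRingEquiv d.H N γ →
    ∃ χ₁ χ₂ χ₃ χ₄ : ℂ,
      (∃ c : ℂ, ∀ z ∈ ball, comp (d.T d.i₁) d.s d.hs₁ (d.a d.i₁) (actM (toBallMat d.τ₀ d.C γ) z) =
        χ₁ * comp (d.T d.i₁) d.s d.hs₁ (d.a d.i₁) z + c) ∧
      (∃ c : ℂ, ∀ z ∈ ball, comp (d.T d.i₂) d.s d.hs₂ (d.a d.i₂) (actM (toBallMat d.τ₀ d.C γ) z) =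
        χ₂ * comp (d.T d.i₂) d.s d.hs₂ (d.a d.i₂) z + c) ∧
      (∃ c : ℂ, ∀ z ∈ ball, comp (d.T d.i₃) (conjEmb d.s) d.hs₃ (d.a d.i₃) (actM (toBallMat d.τ₀ d.C γ) z) =
        χ₃ * comp (d.T d.i₃) (conjEmb d.s) d.hs₃ (d.a d.i₃) z + c) ∧
      (∃ c : ℂ, ∀ z ∈ ball, comp (d.T d.i₄) (conjEmb d.s) d.hs₄ (d.a d.i₄) (actM (toBallMat d.τ₀ d.C γ) z) =
        χ₄ * comp (d.T d.i₄) (conjEmb d.s) d.hs₄ (d.a d.i₄) z + c) ∧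
      χ₁ * χ₂ = χ₃ * χ₄

/-- **The conclusion at a FIXED level `Γ'`**: some Hecke elements of level `Γ'`, some fundamental domain of `Γ'`, non-zero pairing. -/
def conclusionAt (Γ' : Set (Matrix (Fin 3) (Fin 3) E)) : Prop :=
  ∃ h : Fin 4 → HeckeElement E, d.IsHeckeFor Γ' h ∧ ∃ D : Set (Fin 2 → ℂ), d.IsDomain Γ' D ∧ d.pairing D h ≠ 0

/-- (P) for the concrete witness of `d` at its own level `d.Γ` on the canonical domain gives `d.conclusionAt d.Γ`. -/
theorem conclusionAt_of_concrete_P_cocompact (hcc : d.IsCocompact d.Γ)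
    (hP : (d.concreteWitness d.isLevel_self (isDomain_dom d d.isLevel_self).subset_ball
      (isDomain_dom d d.isLevel_self).measurableSet (d.residual_of_cocompact d.isLevel_self hcc)).P) :
    d.conclusionAt d.Γ := by
  obtain ⟨γ, hγ⟩ := hP
  refine ⟨d.heckeOf fun j => (γ j).1, d.isHeckeFor_heckeOf_val γ, dom d d.Γ, isDomain_dom d d.isLevel_self, ?_⟩
  rw [← d.concrete_hodgePairing_eq d.isLevel_self (isDomain_dom d d.isLevel_self).subset_ball
    (isDomain_dom d d.isLevel_self).measurableSet (d.residual_of_cocompact d.isLevel_self hcc) γ]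
  exact hγ

end TargetData

/-- **`P_T4v3` is «for every datum, some deeper level, some N2-lifts into the same tori at it, and the conclusion at that level»** —
by unfolding; nothing is added or removed. -/
theorem P_T4v3_iff_forall : P_T4v3 ↔
    ∀ (F E : Type) [Field F] [NumberField F] [IsGalois ℚ F] [IsCMField F]
      [Field E] [NumberField E] [IsGalois ℚ E] [IsCMField E] (d : TargetData F E),
      ∃ (Γ' : Set (Matrix (Fin 3) (Fin 3) E)) (hΓ' : d.IsLevel Γ') (a' : ∀ i : Fin 4, (Fin 2 → ℂ) → (↥(d.T i) → ℂ))
        (ha' : ∀ i, IsAlbaneseLift (d.T i) (d.Λ i) d.τ₀ d.C Γ' (a' i)),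
        (d.relevel Γ' hΓ'.1 a' ha').N2 ∧ (d.relevel Γ' hΓ'.1 a' ha').conclusionAt Γ' := by
  constructor
  · intro h F E _ _ _ _ _ _ _ _ d
    haveI := d.discrete
    haveI := d.lattice
    obtain ⟨Γ', hΓ', hsub, a', ha', hN2, hh, hhh, D, hD, hne⟩ := h F d.T d.hT E d.hE d.ι d.H d.hH d.hani d.τ₀ d.hdef
      d.C d.hC d.Γ d.hΓ d.s d.Λ d.hΛ d.a d.ha d.i₁ d.i₂ d.i₃ d.i₄ d.h12 d.h34 d.hs₁ d.hs₂ d.hs₃ d.hs₄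
    exact ⟨Γ', ⟨hΓ', hsub⟩, a', ha', hN2, hh, hhh, D, hD, hne⟩
  · intro h F _ _ _ _ T hT E _ _ _ _ hE ι H hH hani τ₀ hdef C hC Γ hΓ s Λ hdisc hlat hΛ a ha i₁ i₂ i₃ i₄ h12 h34
      hs₁ hs₂ hs₃ hs₄
    obtain ⟨Γ', ⟨hΓ', hsub⟩, a', ha', hN2, hh, hhh, D, hD, hne⟩ := h F E ⟨T, hT, hE, ι, H, hH, hani, τ₀, hdef, C, hC, Γ, hΓ,
      s, Λ, hdisc, hlat, hΛ, a, ha, i₁, i₂, i₃, i₄, h12, h34, hs₁, hs₂, hs₃, hs₄⟩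
    exact ⟨Γ', hΓ', hsub, a', ha', hN2, hh, hhh, D, hD, hne⟩

/-- To prove `P_T4v3` it suffices to produce, for every datum, a deeper level, N2-lifts at it and the conclusion there. -/
theorem P_T4v3_of_forall
    (h : ∀ (F E : Type) [Field F] [NumberField F] [IsGalois ℚ F] [IsCMField F]
      [Field E] [NumberField E] [IsGalois ℚ E] [IsCMField E] (d : TargetData F E),
      ∃ (Γ' : Set (Matrix (Fin 3) (Fin 3) E)) (hΓ' : d.IsLevel Γ') (a' : ∀ i : Fin 4, (Fin 2 → ℂ) → (↥(d.T i) → ℂ))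
        (ha' : ∀ i, IsAlbaneseLift (d.T i) (d.Λ i) d.τ₀ d.C Γ' (a' i)),
        (d.relevel Γ' hΓ'.1 a' ha').N2 ∧ (d.relevel Γ' hΓ'.1 a' ha').conclusionAt Γ') : P_T4v3 :=
  P_T4v3_iff_forall.2 h

/-- **`P_T4v3` from (P) for the concrete witness of a chosen N2-quadruple at a cocompact deeper level, on the canonical domain.** -/
theorem P_T4v3_of_concrete_cocompact
    (h : ∀ (F E : Type) [Field F] [NumberField F] [IsGalois ℚ F] [IsCMField F]
      [Field E] [NumberField E] [IsGalois ℚ E] [IsCMField E] (d : TargetData F E),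
      ∃ (Γ' : Set (Matrix (Fin 3) (Fin 3) E)) (hΓ' : d.IsLevel Γ') (a' : ∀ i : Fin 4, (Fin 2 → ℂ) → (↥(d.T i) → ℂ))
        (ha' : ∀ i, IsAlbaneseLift (d.T i) (d.Λ i) d.τ₀ d.C Γ' (a' i)),
        (d.relevel Γ' hΓ'.1 a' ha').N2 ∧
        ∃ hcc : (d.relevel Γ' hΓ'.1 a' ha').IsCocompact Γ',
          ((d.relevel Γ' hΓ'.1 a' ha').concreteWitness (d.relevel Γ' hΓ'.1 a' ha').isLevel_self
            (isDomain_dom _ (d.relevel Γ' hΓ'.1 a' ha').isLevel_self).subset_ball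
            (isDomain_dom _ (d.relevel Γ' hΓ'.1 a' ha').isLevel_self).measurableSet
            ((d.relevel Γ' hΓ'.1 a' ha').residual_of_cocompact (d.relevel Γ' hΓ'.1 a' ha').isLevel_self hcc)).P) :
    P_T4v3 := by
  refine P_T4v3_of_forall fun F E _ _ _ _ _ _ _ _ d => ?_
  obtain ⟨Γ', hΓ', a', ha', hN2, hcc, hP⟩ := h F E d
  exact ⟨Γ', hΓ', a', ha', hN2, (d.relevel Γ' hΓ'.1 a' ha').conclusionAt_of_concrete_P_cocompact hcc hP⟩

end Summit.Ventures.HodgeRepro.Tier4
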